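import Summits.BirchSwinnertonDyer.BirchSwinnertonDyer.Theorems.ResidualThetaTransportAtTwoResidualSignedLambdaLowerCMAtTwoS3BodyOfStations
import Summits.BirchSwinnertonDyer.BirchSwinnertonDyer.Theorems.ResidualThetaTransportAtTwoResidualSignedLambdaLowerCMAtTwoRelayDescends
import HarnessLib

/-!
# stub-ideation k1 g27 — `stub_cmLambdaLower` (crux `ResidualThetaCountLowerPureAtTwo`, stmt-26074): the JUNCTION of the two
# files landed after STUB-PLAN rev 27 — `relay_descends` (12:03Z) × `s3body_sameClass_of_stations` (12:00Z) — in its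
# WEAKEST SUFFICIENT form (family 2, weaken / strengthen), kernel-checked.

EVIDENCE SKETCH ONLY (planner folder; `ledger crux write … Sketch_sidea_k1_g27.lean`). Theorems only: no `def`, no
instance / notation / attribute, no `sorry`. Nothing here proves (R≥)ᵖ, RSL_g, S3″, child A or child B; BSD is NOT proved
by any of this.

WHAT IS CHECKED.
* §1 (generic, any commutative ring / domain `Λ`): the literal conclusion shape of `relay_descends`
  `a * w * E = b * μ * L` (there: `a = C ν`, `b = C u₀`) is turned into the node's station (R)
  `a * E = μ * (L * u)` with `u := b * ↑w⁻¹` **provided `w` is a unit** (`stationR_byName_of_descended`), and more weakly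
  provided `w = C c * w₁` is a unit UP TO A NON-ZERO CONSTANT, the constant migrating to the `ν`-slot
  (`stationR_byName_of_descended_upToConst`): this is the weakest sufficient shape of the S129-torsor output for the node's
  (i_D) at `D := μt` BY NAME (S142) — `u` merely `≠ 0` on the `L⁻`-side, `IsUnit` needed only to MOVE `w` across.
* §2 (pins, `S := range ι`, `p = 2`): **`s3body_sameClass_of_relay_descends`** — the node `s3body_sameClass_of_stations` with
  its (R)-binders `(ν D u hν hD hu hval)` REPLACED by `relay_descends`' hypotheses (`hcol`, `hMT` over `S' ⊇ range ι`,
  `μt ≠ 0`, `u ≠ 0` in `𝒪_{S'}`) + `IsUnit w` + `ν ≠ 0`, child B VERBATIM at `D := μt`; and the alternative plugging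
  `D := C u₀ · μt` (RelayDescends §F docstring) costs exactly one λ-rewrite of child B (`childB_at_C_mul_iff`), so both
  pluggings are admissible and the BY-NAME one is rewrite-free.

References: [Kato2004Asterisque] Thm. 12.5 (1)–(2) (pp. 221–222), §13.8, Thm. 16.6.2 (p. 268); [Pollack2003] Thm. 5.1,
Prop. 6.18; [Washington1997] §13.2; [Sprung2017] Thm. 1.1.
-/

set_option autoImplicit false
set_option linter.dupNamespace false

noncomputable section

open scoped TensorProduct Classical Polynomial

namespace Summit.BirchSwinnertonDyer.BirchSwinnertonDyer.Cruxes.ResidualThetaCountLowerPureAtTwo.SideaK1G27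

open Literature.NumberTheory.EllipticCurves Literature.NumberTheory.EllipticCurves.GreenbergSelmer
open Literature.NumberTheory.EllipticCurves.ModularForms CongruenceSubgroup
open Literature.NumberTheory.GaloisRepresentations NumberField IsDedekindDomain Field
open Summit.BirchSwinnertonDyer.BirchSwinnertonDyer.Theorems
open Summit.BirchSwinnertonDyer.BirchSwinnertonDyer.Theorems.OnePair
open Summit.BirchSwinnertonDyer.BirchSwinnertonDyer.Theorems.ThetaTransport.S3BodyOfStations
open Summit.BirchSwinnertonDyer.BirchSwinnertonDyer.Theorems.ThetaTransport.MazurTateValuesRelay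

universe u

/-! ## §1 Generic: the descended relation ⟹ station (R) BY NAME (`D := μ`), weakest sufficient hypotheses on `w` -/

section Generic

variable {Λ : Type u} [CommRing Λ]

/-- `a·w·E = b·μ·L` with `w` a UNIT ⟹ `a·E = μ·(L·(b·w⁻¹))`: the unit moves to the `L`-side slack `u := b·↑w⁻¹`, the
multiplier `μ` is kept BY NAME (S142 «`D := μt` by name, constant parked in the `u ≠ 0` slot»). -/
theorem stationR_byName_of_descended {a w E b μ L : Λ} (hw : IsUnit w) (h : a * w * E = b * μ * L) :
    a * E = μ * (L * (b * ↑hw.unit⁻¹)) := by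
  have key : a * E = a * w * E * ↑hw.unit⁻¹ := by
    calc a * E = a * E * (w * ↑hw.unit⁻¹) := by rw [IsUnit.mul_val_inv, mul_one]
      _ = a * w * E * ↑hw.unit⁻¹ := by ring
  rw [key, h]; ring

/-- In a domain the slack `u := b·↑w⁻¹` is non-zero as soon as `b ≠ 0` — the node's `hu : u ≠ 0` (nothing stronger is consumed
by (i_D): `λ(Λ/(D·L⁻·u)) = λ(Λ/u) + d + λ(Λ/D) ≥ d + λ(Λ/D)`). -/
theorem slack_ne_zero [IsDomain Λ] {b w : Λ} (hw : IsUnit w) (hb : b ≠ 0) : b * ↑hw.unit⁻¹ ≠ 0 :=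
  mul_ne_zero hb (Units.ne_zero _)

/-- WEAKEST SUFFICIENT torsor output: `w = c·w₁` a unit UP TO A CONSTANT `c` (`c` need not be a unit). Then
`a·w·E = b·μ·L` ⟹ `(a·c)·E = μ·(L·(b·w₁⁻¹))` — the constant migrates to the `ν`-slot (`ν ↦ ν·c`, still `λ`-invisible in the
node: `finrank_baseChange_quotient_span_C_mul_eq`), the unit to the slack. A `w` with positive `λ`-invariant is NOT admissible
(it would lower `λ(e 𝒸 z)` below `d + λ(Λ/μt)` and (i_D) fails), so «unit up to a non-zero constant» is exactly the weakest shape. -/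
theorem stationR_byName_of_descended_upToConst {a c w₁ E b μ L : Λ} (hw₁ : IsUnit w₁)
    (h : a * (c * w₁) * E = b * μ * L) : a * c * E = μ * (L * (b * ↑hw₁.unit⁻¹)) :=
  stationR_byName_of_descended hw₁ (by rw [← h]; ring)

/-- The alternative plugging of RelayDescends §F's docstring, `D := b·μ` with slack `↑w⁻¹`: also station (R). -/
theorem stationR_atConstMul_of_descended {a w E b μ L : Λ} (hw : IsUnit w) (h : a * w * E = b * μ * L) :
    a * E = b * μ * (L * ↑hw.unit⁻¹) := by
  rw [stationR_byName_of_descended hw h]; ring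

/-- A pre-image under an (injective or not) ring map of a non-zero element is non-zero (`u₀ ≠ 0` from `incl u₀ = u`, `u ≠ 0`). -/
theorem ne_zero_of_map_eq {R R' : Type*} [Semiring R] [Semiring R'] (f : R →+* R') {x : R} {y : R'} (hy : y ≠ 0)
    (h : f x = y) : x ≠ 0 := by
  rintro rfl; exact hy (by rw [← h, map_zero])

/-- `C c ≠ 0` in `A⟦T⟧` for `c ≠ 0`. -/
theorem C_ne_zero_of_ne_zero {A : Type*} [CommRing A] {c : A} (hc : c ≠ 0) : (PowerSeries.C c : PowerSeries A) ≠ 0 :=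
  fun h0 ↦ hc (by simpa using congrArg PowerSeries.constantCoeff h0)

end Generic

/-! ## §2 At the pins (`S := range ι`, `p = 2`): the node with (R) supplied by `relay_descends` -/

section Pins

variable {M : ℕ} {g : CuspForm (Gamma0 M) 2} {ι : coeffField g →+* PadicAlgCl 2} {Ω : ℂ}
variable {W : WeierstrassCurve ℚ} [W.IsElliptic] {κ : ZpExtension ℚ 2} {γ : absoluteGaloisGroup ℚ}
  {S₀ : Finset (HeightOneSpectrum (𝓞 ℚ))} {n : ℕ} {ρ : FramedGaloisRep ℚ ↥(padicCoeffIntegers (Set.range ι)) 2}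
  {Θ : ∀ v : HeightOneSpectrum (𝓞 ℚ), ((2 : ℕ) : 𝓞 ℚ) ∈ v.asIdeal →
    (Cofree ρ ↥(padicCoeffField (Set.range ι)) ≃+ (Fin n → ↥(W.geomPrimaryTorsion 2)))}
  {hΘ : ∀ v hv (δ : absoluteGaloisGroup (v.adicCompletion ℚ)) m i,
    Θ v hv (resGalOfEmb (closureEmb (K := ℚ) (v.adicCompletion ℚ)) δ • m) i =
      resGalOfEmb (closureEmb (K := ℚ) (v.adicCompletion ℚ)) δ • Θ v hv m i}
  {I : Kato2004.IwasawaH1DataCoeff (FramedGaloisRep.toGaloisRep ρ) 2 κ γ}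
  {Sg : AddSubgroup (subgroupH1 κ.kerSubgroup (Cofree ρ ↥(padicCoeffField (Set.range ι))))}
  [Module ↥(padicCoeffIntegers (Set.range ι)) ↥Sg]

/-- **Child B at `C u₀ · μt` ↔ child B at `μt`** (constants are `λ`-invisible): the alternative plugging `D := C u₀ · μt` of
RelayDescends §F costs exactly this rewrite; the BY-NAME plugging `D := μt` (S142) costs nothing. [cite: Washington1997, §13.2] -/
theorem childB_at_C_mul_iff [IsDiscreteValuationRing (coeffO (Set.range ι))]
    [IsAdicComplete (IsLocalRing.maximalIdeal (coeffO (Set.range ι))) (coeffO (Set.range ι))]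
    {u₀ : coeffO (Set.range ι)} (hu₀ : u₀ ≠ 0) {μt : IwasawaAlgebraO (Set.range ι)} (hμ : μt ≠ 0) (X B : ℕ) :
    X ≤ B + lamO (Set.range ι) (IwasawaAlgebraO (Set.range ι) ⧸ Ideal.span {(PowerSeries.C u₀ : IwasawaAlgebraO (Set.range ι)) * μt}) ↔
      X ≤ B + lamO (Set.range ι) (IwasawaAlgebraO (Set.range ι) ⧸ Ideal.span {μt}) := by
  rw [show lamO (Set.range ι) (IwasawaAlgebraO (Set.range ι) ⧸ Ideal.span {(PowerSeries.C u₀ : IwasawaAlgebraO (Set.range ι)) * μt}) =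
      lamO (Set.range ι) (IwasawaAlgebraO (Set.range ι) ⧸ Ideal.span {μt}) from
    CharIdealLambda.finrank_baseChange_quotient_span_C_mul_eq (FractionRing (coeffO (Set.range ι))) hu₀ hμ]

set_option maxHeartbeats 1600000 in
/-- **The node with station (R) supplied by `relay_descends` (PROVED; the junction of the two post-rev-27 landings).**
Binders = `s3body_sameClass_of_stations`' with `(ν D u hν hD hu hval)` replaced by: the relay's column congruences `hcol` for
`E := e (𝒸 z)` at the EVEN levels, the Mazur–Tate value congruences `hMT` over `S' ⊇ range ι` with multiplier `C u · μt`
(`u ∈ 𝒪_{S'} ∖ 0`, e.g. `u = 2^a·q`, T82/S142) and right side `C ν · w · Q m` (`ν ∈ 𝒪 ∖ 0`, `w ∈ Λ_𝒪` a UNIT — the S129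
torsor's output; `IsUnit w` is load-bearing, see §1), `μt ≠ 0`; child B VERBATIM at `D := μt`. Conclusion = the node's, at the
SAME class `z` and `D := μt` BY NAME; the relay's constant `u₀` and the unit `w⁻¹` sit in the slack `u := C u₀ · w⁻¹ ≠ 0`.
[cite: Kato2004Asterisque, Thm. 12.5 (1)–(2) (pp. 221–222), Thm. 16.6.2 (p. 268)] [cite: Pollack2003, Thm. 5.1] -/
theorem s3body_sameClass_of_relay_descends [IsDiscreteValuationRing (coeffO (Set.range ι))]
    [IsAdicComplete (IsLocalRing.maximalIdeal (coeffO (Set.range ι))) (coeffO (Set.range ι))]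
    [Module (coeffO (Set.range ι)) I.H] [IsScalarTower (coeffO (Set.range ι)) (IwasawaAlgebraO (Set.range ι)) I.H]
    (π : OnePairPins (Set.range ι) W κ γ S₀ n ρ Θ hΘ I Sg)
    {Lp Lm : IwasawaAlgebraO (Set.range ι)} (hL : IsPollackPairK g ι Ω Lp Lm) (hLm : Lm ≠ 0) {d : ℕ}
    (hd : lamO (Set.range ι) (IwasawaAlgebraO (Set.range ι) ⧸ Ideal.span {Lm}) = d) (z : I.H)
    -- (E)
    (e : (Fin n → PowerSeries ℤ_[2]) ≃+ IwasawaAlgebraO (Set.range ι))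
    (hlin : ∀ (s : IwasawaAlgebraO (Set.range ι)) (x : I.H), x ∈ Submodule.span (IwasawaAlgebraO (Set.range ι)) ({z} : Set I.H) →
      e (π.cvec (s • x)) = s * e (π.cvec x))
    -- (DESC)
    (hDesc : ∀ (z : I.H) (h : IwasawaAlgebraO (Set.range ι)), h ≠ 0 → (∀ r : IwasawaAlgebraO (Set.range ι), e (π.cvec (r • z)) = r * h) →
      Module.Finite ℚ_[2] (TensorProduct ℤ_[2] ℚ_[2] (π.colocdQuot z)) ∧
        π.f * lamO (Set.range ι) (IwasawaAlgebraO (Set.range ι) ⧸ Ideal.span {h}) ≤ lamTwo 2 (π.colocdQuot z))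
    -- (R) := `relay_descends`' inputs for `E := e (𝒸 z)`
    {S' : Set (PadicAlgCl 2)} [FiniteDimensional ℚ_[2] (padicCoeffField S')] (h : Set.range ι ⊆ S')
    (Q : ℕ → IwasawaAlgebraO (Set.range ι)) (μt : IwasawaAlgebraO (Set.range ι)) (hμ : μt ≠ 0)
    (ν : coeffO (Set.range ι)) (hν : ν ≠ 0) (w : IwasawaAlgebraO (Set.range ι)) (hw : IsUnit w)
    (u : padicCoeffIntegers S') (hu : u ≠ 0)
    (hcol : ∀ m : ℕ, (((cyclotomicOmega 2 (2 * m)).map (Int.castRingHom (padicCoeffIntegers (Set.range ι))) :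
        (padicCoeffIntegers (Set.range ι))[X]) : IwasawaAlgebraO (Set.range ι)) ∣
      Q m + ((((-1) ^ m * cyclotomicOmegaMinus 2 (2 * m)).map (Int.castRingHom (padicCoeffIntegers (Set.range ι))) :
        (padicCoeffIntegers (Set.range ι))[X]) : IwasawaAlgebraO (Set.range ι)) * e (π.cvec z))
    (hMT : ∀ m : ℕ, ∃ (k : ℕ) (q' : IwasawaAlgebraO S'),
      PowerSeries.C (((2 : ℕ) : PadicAlgCl 2) ^ k) *
          (iwasawaOToPowerSeries S' (PowerSeries.C u * (PowerSeries.map (Subring.inclusion (padicCoeffIntegers_mono h))) μt) *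
              (((mazurTateElementK g Ω 2 (2 * m)).map ι : (PadicAlgCl 2)[X]) : PowerSeries (PadicAlgCl 2)) -
            iwasawaOToPowerSeries S' ((PowerSeries.map (Subring.inclusion (padicCoeffIntegers_mono h))) (PowerSeries.C ν * w * Q m))) =
        (((cyclotomicOmega 2 (2 * m)).map (Int.castRingHom (PadicAlgCl 2)) : (PadicAlgCl 2)[X]) : PowerSeries (PadicAlgCl 2)) *
          iwasawaOToPowerSeries S' q')
    -- (B) child B VERBATIM at `D := μt`
    (hB : Module.Finite (FractionRing (coeffO (Set.range ι)))
        (TensorProduct (coeffO (Set.range ι)) (FractionRing (coeffO (Set.range ι))) (zetaQuot I z)) ∧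
      lamO (Set.range ι) (zetaQuot I z) ≤ lamO (Set.range ι) (CharacterModule ↥π.Sel₀) +
        lamO (Set.range ι) (IwasawaAlgebraO (Set.range ι) ⧸ Ideal.span {μt})) :
    ∃ (z : I.H) (D : IwasawaAlgebraO (Set.range ι)), D ≠ 0 ∧ Module.Finite ℚ_[2] (TensorProduct ℤ_[2] ℚ_[2] (π.colocdQuot z)) ∧
      π.f * (d + lamO (Set.range ι) (IwasawaAlgebraO (Set.range ι) ⧸ Ideal.span {D})) ≤ lamTwo 2 (π.colocdQuot z) ∧
      Module.Finite (FractionRing (coeffO (Set.range ι)))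
        (TensorProduct (coeffO (Set.range ι)) (FractionRing (coeffO (Set.range ι))) (zetaQuot I z)) ∧
      lamO (Set.range ι) (zetaQuot I z) ≤ lamO (Set.range ι) (CharacterModule ↥π.Sel₀) +
        lamO (Set.range ι) (IwasawaAlgebraO (Set.range ι) ⧸ Ideal.span {D}) := by
  obtain ⟨u₀, hu₀u, hE⟩ := relay_descends h hL (e (π.cvec z)) Q μt hμ ν w u hcol hMT
  have hu₀ : u₀ ≠ 0 := ne_zero_of_map_eq _ hu hu₀u
  have hCu₀ : (PowerSeries.C u₀ : IwasawaAlgebraO (Set.range ι)) ≠ 0 := C_ne_zero_of_ne_zero hu₀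
  exact s3body_sameClass_of_stations π hLm hd z e hlin hDesc ν μt _ hν hμ (slack_ne_zero hw hCu₀)
    (stationR_byName_of_descended hw hE) hB

/-- **Same, with the alternative plugging `D := C u₀ · μt`** (RelayDescends §F docstring): admissible too, the node's `∃ D`
absorbing it, at the price of `childB_at_C_mul_iff`; recorded so that neither plugging is mistaken for a seam. -/
theorem s3body_sameClass_of_relay_descends' [IsDiscreteValuationRing (coeffO (Set.range ι))]
    [IsAdicComplete (IsLocalRing.maximalIdeal (coeffO (Set.range ι))) (coeffO (Set.range ι))]
    [Module (coeffO (Set.range ι)) I.H] [IsScalarTower (coeffO (Set.range ι)) (IwasawaAlgebraO (Set.range ι)) I.H]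
    (π : OnePairPins (Set.range ι) W κ γ S₀ n ρ Θ hΘ I Sg)
    {Lm : IwasawaAlgebraO (Set.range ι)} (hLm : Lm ≠ 0) {d : ℕ}
    (hd : lamO (Set.range ι) (IwasawaAlgebraO (Set.range ι) ⧸ Ideal.span {Lm}) = d) (z : I.H)
    (e : (Fin n → PowerSeries ℤ_[2]) ≃+ IwasawaAlgebraO (Set.range ι))
    (hlin : ∀ (s : IwasawaAlgebraO (Set.range ι)) (x : I.H), x ∈ Submodule.span (IwasawaAlgebraO (Set.range ι)) ({z} : Set I.H) →
      e (π.cvec (s • x)) = s * e (π.cvec x))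
    (hDesc : ∀ (z : I.H) (h : IwasawaAlgebraO (Set.range ι)), h ≠ 0 → (∀ r : IwasawaAlgebraO (Set.range ι), e (π.cvec (r • z)) = r * h) →
      Module.Finite ℚ_[2] (TensorProduct ℤ_[2] ℚ_[2] (π.colocdQuot z)) ∧
        π.f * lamO (Set.range ι) (IwasawaAlgebraO (Set.range ι) ⧸ Ideal.span {h}) ≤ lamTwo 2 (π.colocdQuot z))
    -- the DESCENDED relation (= `relay_descends`' conclusion) and its side conditions
    (μt : IwasawaAlgebraO (Set.range ι)) (hμ : μt ≠ 0) (ν u₀ : coeffO (Set.range ι)) (hν : ν ≠ 0) (hu₀ : u₀ ≠ 0)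
    (w : IwasawaAlgebraO (Set.range ι)) (hw : IsUnit w)
    (hE : PowerSeries.C ν * w * e (π.cvec z) = PowerSeries.C u₀ * μt * Lm)
    (hB : Module.Finite (FractionRing (coeffO (Set.range ι)))
        (TensorProduct (coeffO (Set.range ι)) (FractionRing (coeffO (Set.range ι))) (zetaQuot I z)) ∧
      lamO (Set.range ι) (zetaQuot I z) ≤ lamO (Set.range ι) (CharacterModule ↥π.Sel₀) +
        lamO (Set.range ι) (IwasawaAlgebraO (Set.range ι) ⧸ Ideal.span {μt})) :
    ∃ (z : I.H) (D : IwasawaAlgebraO (Set.range ι)), D ≠ 0 ∧ Module.Finite ℚ_[2] (TensorProduct ℤ_[2] ℚ_[2] (π.colocdQuot z)) ∧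
      π.f * (d + lamO (Set.range ι) (IwasawaAlgebraO (Set.range ι) ⧸ Ideal.span {D})) ≤ lamTwo 2 (π.colocdQuot z) ∧
      Module.Finite (FractionRing (coeffO (Set.range ι)))
        (TensorProduct (coeffO (Set.range ι)) (FractionRing (coeffO (Set.range ι))) (zetaQuot I z)) ∧
      lamO (Set.range ι) (zetaQuot I z) ≤ lamO (Set.range ι) (CharacterModule ↥π.Sel₀) +
        lamO (Set.range ι) (IwasawaAlgebraO (Set.range ι) ⧸ Ideal.span {D}) := by
  have hCu₀ : (PowerSeries.C u₀ : IwasawaAlgebraO (Set.range ι)) ≠ 0 := C_ne_zero_of_ne_zero hu₀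
  exact s3body_sameClass_of_stations π hLm hd z e hlin hDesc ν (PowerSeries.C u₀ * μt) _ hν (mul_ne_zero hCu₀ hμ)
    (Units.ne_zero _) (stationR_atConstMul_of_descended hw hE) ⟨hB.1, (childB_at_C_mul_iff hu₀ hμ _ _).mpr hB.2⟩

end Pins


end Summit.BirchSwinnertonDyer.BirchSwinnertonDyer.Cruxes.ResidualThetaCountLowerPureAtTwo.SideaK1G27

end
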